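import Mathlib
import Summits.Ventures.PercRepro2.CoinChainEnteredPart

/-!
# The universal PURE chain for the PRINCIPAL-FILTER gates
(blind cell PercRepro2, night-2 g23; proofs/NIGHT2-DARC.md §63.4)

For an ENTERED cluster `z` the filter gate `d_z W = d W · 1[z ⊆ W]` — the gate keeps exactly the
entered clusters above `z` and kills the rest — is admissible (`filterGate_lsm`, `filterGate_cross_c`,
`filterGate_cross_d`, `filterGate_ratio`: the hypotheses of the chain theorems), and its ENTERED part
`∑_{z ⊆ W} ν d (b0 x − b1)(b0 y − b2)` is nonnegative: FKG on the sublattice `↑z` and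
`level_holley` on the up-set `↑z ⊆ D` (`filterGate_entered_nonneg`).  Hence
`pureChain_functional_nonneg_of_enteredPart` closes (Q′) and the pure chain at EVERY `ρ ∈ [0, 1]`
for every pair of nonnegative increasing markers (`pureChain_functional_nonneg_of_filterGate`).
Since (Q′) is affine in the gate, the same follows for every gate whose tilt `d'/d` on the entered
clusters is a nonnegative combination of indicators of entered principal filters and a constant
(paper §63.4); the filters ↑z with z NOT entered are the smallest open instances.
-/

namespace Summit.Ventures.PercRepro2.Coin

open Classical

section FilterGateHyps

variable {V : Type*} [DecidableEq V] {R : Type*} [Field R] [LinearOrder R] [IsStrictOrderedRing R]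

omit [IsStrictOrderedRing R] in
/-- The filter gate is nonnegative. -/
lemma filterGate_nonneg (d : Finset V → R) (hd0 : ∀ W, 0 ≤ d W) (z : Finset V) (W : Finset V) :
    0 ≤ (if z ⊆ W then d W else 0) := by
  split_ifs <;> first | exact hd0 W | exact le_rfl

omit [IsStrictOrderedRing R] in
/-- The filter gate is below `d`. -/
lemma filterGate_le (d : Finset V → R) (hd0 : ∀ W, 0 ≤ d W) (z : Finset V) (W : Finset V) :
    (if z ⊆ W then d W else 0) ≤ d W := by
  split_ifs <;> first | exact le_rfl | exact hd0 W

/-- The filter gate is log-supermodular. -/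
lemma filterGate_lsm (d : Finset V → R) (hd0 : ∀ W, 0 ≤ d W)
    (hdd : ∀ s t, d s * d t ≤ d (s ∩ t) * d (s ∪ t)) (z : Finset V) (s t : Finset V) :
    (if z ⊆ s then d s else 0) * (if z ⊆ t then d t else 0) ≤
      (if z ⊆ s ∩ t then d (s ∩ t) else 0) * (if z ⊆ s ∪ t then d (s ∪ t) else 0) := by
  by_cases hs : z ⊆ s
  · by_cases ht : z ⊆ t
    · have hi : z ⊆ s ∩ t := Finset.subset_inter hs ht
      have hu : z ⊆ s ∪ t := hs.trans Finset.subset_union_left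
      rw [if_pos hs, if_pos ht, if_pos hi, if_pos hu]; exact hdd s t
    · rw [if_neg ht, mul_zero]
      exact mul_nonneg (filterGate_nonneg d hd0 z _) (filterGate_nonneg d hd0 z _)
  · rw [if_neg hs, zero_mul]
    exact mul_nonneg (filterGate_nonneg d hd0 z _) (filterGate_nonneg d hd0 z _)

/-- Joint log-supermodularity of `c` and the filter gate. -/
lemma filterGate_cross_c (c d : Finset V → R) (hc0 : ∀ W, 0 ≤ c W) (hd0 : ∀ W, 0 ≤ d W)
    (hcd : ∀ s t, c s * d t ≤ c (s ∩ t) * d (s ∪ t)) (z : Finset V) (s t : Finset V) :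
    c s * (if z ⊆ t then d t else 0) ≤ c (s ∩ t) * (if z ⊆ s ∪ t then d (s ∪ t) else 0) := by
  by_cases ht : z ⊆ t
  · have hu : z ⊆ s ∪ t := ht.trans Finset.subset_union_right
    rw [if_pos ht, if_pos hu]; exact hcd s t
  · rw [if_neg ht, mul_zero]; exact mul_nonneg (hc0 _) (filterGate_nonneg d hd0 z _)

/-- Joint log-supermodularity of `d` and the filter gate. -/
lemma filterGate_cross_d (d : Finset V → R) (hd0 : ∀ W, 0 ≤ d W)
    (hdd : ∀ s t, d s * d t ≤ d (s ∩ t) * d (s ∪ t)) (z : Finset V) (s t : Finset V) :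
    d s * (if z ⊆ t then d t else 0) ≤ d (s ∩ t) * (if z ⊆ s ∪ t then d (s ∪ t) else 0) := by
  by_cases ht : z ⊆ t
  · have hu : z ⊆ s ∪ t := ht.trans Finset.subset_union_right
    rw [if_pos ht, if_pos hu]; exact hdd s t
  · rw [if_neg ht, mul_zero]; exact mul_nonneg (hd0 _) (filterGate_nonneg d hd0 z _)

/-- The ratio of the filter gate to `c` is increasing. -/
lemma filterGate_ratio (c d : Finset V → R) (hc0 : ∀ W, 0 ≤ c W) (hd0 : ∀ W, 0 ≤ d W)
    (hratio : ∀ s t, s ⊆ t → d s * c t ≤ c s * d t) (z : Finset V) (s t : Finset V)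
    (hst : s ⊆ t) :
    (if z ⊆ s then d s else 0) * c t ≤ c s * (if z ⊆ t then d t else 0) := by
  by_cases hs : z ⊆ s
  · have ht : z ⊆ t := hs.trans hst
    rw [if_pos hs, if_pos ht]; exact hratio s t hst
  · rw [if_neg hs, zero_mul]; exact mul_nonneg (hc0 _) (filterGate_nonneg d hd0 z _)

end FilterGateHyps

section FilterGateEntered

variable {V : Type*} [DecidableEq V] {R : Type*} [Field R] [LinearOrder R] [IsStrictOrderedRing R]

/-- **The entered part of the filter gate functional is nonnegative** (FKG on the filter
`↑z` and `level_holley` on it): with `b0 b1 b2` the moments of the world-1 `R`-law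
`ν·chainMix ∅ ent' 1 c d` and `z` an entered cluster,
`∑_{W meets ent'} ν (d·1[z ⊆ W]) (b0 x − b1)(b0 y − b2) ≥ 0`. -/
theorem filterGate_entered_nonneg (U ent' : Finset V) (ν c d : Finset V → R) (z : Finset V)
    (hz : ∃ r ∈ ent', r ∈ z) (hν0 : ∀ W, 0 ≤ ν W)
    (hν : ∀ s ⊆ U, ∀ t ⊆ U, ν s * ν t ≤ ν (s ∩ t) * ν (s ∪ t))
    (hc0 : ∀ W, 0 ≤ c W) (hd0 : ∀ W, 0 ≤ d W) (hdc : ∀ W, d W ≤ c W)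
    (hdd : ∀ s t, d s * d t ≤ d (s ∩ t) * d (s ∪ t))
    (hcd : ∀ s t, c s * d t ≤ c (s ∩ t) * d (s ∪ t))
    (x y : Finset V → R) (hx0 : ∀ W, 0 ≤ x W) (hy0 : ∀ W, 0 ≤ y W)
    (hxm : ∀ s t, x s ≤ x (s ∪ t)) (hym : ∀ s t, y s ≤ y (s ∪ t)) :
    0 ≤ ∑ W ∈ U.powerset.filter (fun W => ∃ r ∈ ent', r ∈ W),
        ν W * (if z ⊆ W then d W else 0) *
        (((∑ W ∈ U.powerset, ν W * chainMix ∅ ent' 1 c d W) * x W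
            - (∑ W ∈ U.powerset, ν W * chainMix ∅ ent' 1 c d W * x W)) *
          ((∑ W ∈ U.powerset, ν W * chainMix ∅ ent' 1 c d W) * y W
            - (∑ W ∈ U.powerset, ν W * chainMix ∅ ent' 1 c d W * y W))) := by
  set b0 := ∑ W ∈ U.powerset, ν W * chainMix ∅ ent' 1 c d W with hb0
  set b1 := ∑ W ∈ U.powerset, ν W * chainMix ∅ ent' 1 c d W * x W with hb1
  set b2 := ∑ W ∈ U.powerset, ν W * chainMix ∅ ent' 1 c d W * y W with hb2
  -- the sum over the entered clusters of the filter gate is the sum over the filter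
  have hzmeet : ∀ W : Finset V, z ⊆ W → ∃ r ∈ ent', r ∈ W := by
    intro W hW; obtain ⟨r, hr, hrz⟩ := hz; exact ⟨r, hr, hW hrz⟩
  have hsum : ∑ W ∈ U.powerset.filter (fun W => ∃ r ∈ ent', r ∈ W),
        ν W * (if z ⊆ W then d W else 0) * ((b0 * x W - b1) * (b0 * y W - b2)) =
      ∑ W ∈ U.powerset.filter (fun W => z ⊆ W), ν W * d W * ((b0 * x W - b1) * (b0 * y W - b2)) := by
    rw [Finset.sum_filter, Finset.sum_filter]
    refine Finset.sum_congr rfl fun W _ => ?_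
    by_cases hzW : z ⊆ W
    · rw [if_pos (hzmeet W hzW), if_pos hzW, if_pos hzW]
    · rw [if_neg hzW, mul_zero, zero_mul, if_neg hzW]
      split_ifs <;> simp
  rw [hsum, centred_expand]
  -- the filter moments
  set rz := ∑ W ∈ U.powerset.filter (fun W => z ⊆ W), ν W * d W with hrz
  set xz := ∑ W ∈ U.powerset.filter (fun W => z ⊆ W), ν W * d W * x W with hxz
  set yz := ∑ W ∈ U.powerset.filter (fun W => z ⊆ W), ν W * d W * y W with hyz
  set xyz := ∑ W ∈ U.powerset.filter (fun W => z ⊆ W), ν W * d W * (x W * y W) with hxyz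
  have hL0 : ∀ W, 0 ≤ ν W * d W := fun W => mul_nonneg (hν0 W) (hd0 W)
  -- FKG on the filter
  have hFKG : xz * yz ≤ rz * xyz := by
    rw [hxz, hyz, hrz, hxyz]
    simp only [Finset.sum_filter]
    have n₁ : ∀ W, (0 : R) ≤ (if z ⊆ W then ν W * d W * x W else 0) := fun W => by
      split_ifs <;> first | exact le_rfl | exact mul_nonneg (hL0 W) (hx0 W)
    have n₂ : ∀ W, (0 : R) ≤ (if z ⊆ W then ν W * d W * y W else 0) := fun W => by
      split_ifs <;> first | exact le_rfl | exact mul_nonneg (hL0 W) (hy0 W)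
    have n₃ : ∀ W, (0 : R) ≤ (if z ⊆ W then ν W * d W else 0) := fun W => by
      split_ifs <;> first | exact le_rfl | exact hL0 W
    have n₄ : ∀ W, (0 : R) ≤ (if z ⊆ W then ν W * d W * (x W * y W) else 0) := fun W => by
      split_ifs <;> first | exact le_rfl | exact mul_nonneg (hL0 W) (mul_nonneg (hx0 W) (hy0 W))
    refine ad_pointwise U _ _ _ _ n₁ n₂ n₃ n₄ ?_
    intro s hs t ht
    by_cases h1 : z ⊆ s
    · by_cases h2 : z ⊆ t
      · have h3 : z ⊆ s ∩ t := Finset.subset_inter h1 h2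
        have h4 : z ⊆ s ∪ t := h1.trans Finset.subset_union_left
        rw [if_pos h1, if_pos h2, if_pos h3, if_pos h4]
        have e1 : ν s * ν t ≤ ν (s ∩ t) * ν (s ∪ t) := hν s hs t ht
        have e2 := hdd s t
        have e3 := hxm s t
        have e4 : y t ≤ y (s ∪ t) := by rw [Finset.union_comm]; exact hym t s
        calc ν s * d s * x s * (ν t * d t * y t)
            = (ν s * ν t) * (d s * d t) * (x s * y t) := by ring
          _ ≤ (ν (s ∩ t) * ν (s ∪ t)) * (d (s ∩ t) * d (s ∪ t)) * (x (s ∪ t) * y (s ∪ t)) := by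
              apply mul_le_mul (mul_le_mul e1 e2 (mul_nonneg (hd0 _) (hd0 _))
                (mul_nonneg (hν0 _) (hν0 _)))
                (mul_le_mul e3 e4 (hy0 _) (hx0 _)) (mul_nonneg (hx0 _) (hy0 _))
                (mul_nonneg (mul_nonneg (hν0 _) (hν0 _)) (mul_nonneg (hd0 _) (hd0 _)))
          _ = ν (s ∩ t) * d (s ∩ t) * (ν (s ∪ t) * d (s ∪ t) * (x (s ∪ t) * y (s ∪ t))) := by ring
      · rw [if_neg h2, mul_zero]; exact mul_nonneg (n₃ _) (n₄ _)
    · rw [if_neg h1, zero_mul]; exact mul_nonneg (n₃ _) (n₄ _)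
  -- level_holley on the filter: the gate's filter means are above the R-means
  have hmix0 : ∀ W, 0 ≤ chainMix ∅ ent' 1 c d W :=
    chainMix_nonneg ∅ ent' zero_le_one le_rfl hc0 hd0
  have hG0 : ∀ W, 0 ≤ ν W * chainMix ∅ ent' 1 c d W := fun W => mul_nonneg (hν0 W) (hmix0 W)
  have hG'0 : ∀ W, 0 ≤ ν W * (if z ⊆ W then d W else 0) :=
    fun W => mul_nonneg (hν0 W) (filterGate_nonneg d hd0 z W)
  have wML : ∀ s ⊆ U, ∀ t ⊆ U, (∃ r ∈ ent', r ∈ s) →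
      ν s * (if z ⊆ s then d s else 0) * (ν t * chainMix ∅ ent' 1 c d t) ≤
        ν (s ∩ t) * chainMix ∅ ent' 1 c d (s ∩ t) * (ν (s ∪ t) * (if z ⊆ s ∪ t then d (s ∪ t) else 0)) := by
    intro s hs t ht _
    have hcross := chain_cross_holley ∅ ent' 1 zero_le_one le_rfl c d
      (fun W => if z ⊆ W then d W else 0) hdc (filterGate_cross_c c d hc0 hd0 hcd z)
      (filterGate_cross_d d hd0 hdd z) (filterGate_nonneg d hd0 z) s t
    have e1 : ν s * ν t ≤ ν (s ∩ t) * ν (s ∪ t) := hν s hs t ht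
    calc ν s * (if z ⊆ s then d s else 0) * (ν t * chainMix ∅ ent' 1 c d t)
        = (ν s * ν t) * ((if z ⊆ s then d s else 0) * chainMix ∅ ent' 1 c d t) := by ring
      _ ≤ (ν (s ∩ t) * ν (s ∪ t)) * (chainMix ∅ ent' 1 c d (s ∩ t) * (if z ⊆ s ∪ t then d (s ∪ t) else 0)) :=
          mul_le_mul e1 hcross (mul_nonneg (filterGate_nonneg d hd0 z _) (hmix0 _))
            (mul_nonneg (hν0 _) (hν0 _))
      _ = ν (s ∩ t) * chainMix ∅ ent' 1 c d (s ∩ t) * (ν (s ∪ t) * (if z ⊆ s ∪ t then d (s ∪ t) else 0)) := by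
          ring
  have hP : ∀ s ⊆ U, ∀ t ⊆ U, z ⊆ s → ν s * (if z ⊆ s then d s else 0) ≠ 0 →
      ν t * chainMix ∅ ent' 1 c d t ≠ 0 → z ⊆ s ∪ t ∧ (∃ r ∈ ent', r ∈ s) := by
    intro s _ t _ hzs _ _
    exact ⟨hzs.trans Finset.subset_union_left, hzmeet s hzs⟩
  have hLx := level_holley U ent' (fun W => ν W * chainMix ∅ ent' 1 c d W)
    (fun W => ν W * (if z ⊆ W then d W else 0)) x hG0 hG'0 hx0 hxm wML (fun W => z ⊆ W) hP
  have hLy := level_holley U ent' (fun W => ν W * chainMix ∅ ent' 1 c d W)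
    (fun W => ν W * (if z ⊆ W then d W else 0)) y hG0 hG'0 hy0 hym wML (fun W => z ⊆ W) hP
  -- identify the filtered gate sums with the filter moments
  have erz : ∑ W ∈ U.powerset.filter (fun W => z ⊆ W), ν W * (if z ⊆ W then d W else 0) = rz := by
    rw [hrz]; refine Finset.sum_congr rfl fun W hW => ?_
    rw [if_pos (Finset.mem_filter.1 hW).2]
  have exz : ∑ W ∈ U.powerset.filter (fun W => z ⊆ W), ν W * (if z ⊆ W then d W else 0) * x W = xz := by
    rw [hxz]; refine Finset.sum_congr rfl fun W hW => ?_
    rw [if_pos (Finset.mem_filter.1 hW).2]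
  have eyz : ∑ W ∈ U.powerset.filter (fun W => z ⊆ W), ν W * (if z ⊆ W then d W else 0) * y W = yz := by
    rw [hyz]; refine Finset.sum_congr rfl fun W hW => ?_
    rw [if_pos (Finset.mem_filter.1 hW).2]
  rw [erz, exz] at hLx
  rw [erz, eyz] at hLy
  -- hLx : rz * b1 ≤ b0 * xz ; hLy : rz * b2 ≤ b0 * yz
  have hrz0 : 0 ≤ rz := Finset.sum_nonneg fun W _ => hL0 W
  have hb00 : 0 ≤ b0 := Finset.sum_nonneg fun W _ => hG0 W
  -- the cleared identity: rz · expr = b0² (rz xyz − xz yz) + (b0 xz − b1 rz)(b0 yz − b2 rz)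
  have key : rz * (b0 * b0 * xyz - b0 * b2 * xz - b0 * b1 * yz + b1 * b2 * rz) =
      b0 * b0 * (rz * xyz - xz * yz) + (b0 * xz - b1 * rz) * (b0 * yz - b2 * rz) := by ring
  have hpos : 0 ≤ rz * (b0 * b0 * xyz - b0 * b2 * xz - b0 * b1 * yz + b1 * b2 * rz) := by
    rw [key]
    refine add_nonneg (mul_nonneg (mul_nonneg hb00 hb00) (by linarith)) (mul_nonneg ?_ ?_)
    · linarith [hLx]
    · linarith [hLy]
  rcases eq_or_lt_of_le hrz0 with hrz_eq | hrz_pos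
  · -- the filter carries no mass: every filter moment vanishes
    have hzero : ∀ W ∈ U.powerset.filter (fun W => z ⊆ W), ν W * d W = 0 := by
      have := (Finset.sum_eq_zero_iff_of_nonneg (fun W _ => hL0 W)).1 hrz_eq.symm
      exact this
    have e1 : xyz = 0 := Finset.sum_eq_zero fun W hW => by rw [hzero W hW, zero_mul]
    have e2 : xz = 0 := Finset.sum_eq_zero fun W hW => by rw [hzero W hW, zero_mul]
    have e3 : yz = 0 := Finset.sum_eq_zero fun W hW => by rw [hzero W hW, zero_mul]
    rw [e1, e2, e3, ← hrz_eq]; ring_nf; exact le_rfl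
  · exact (mul_nonneg_iff_of_pos_left hrz_pos).mp hpos

end FilterGateEntered

section FilterGateMain

variable {V : Type*} [DecidableEq V] {R : Type*} [Field R] [LinearOrder R] [IsStrictOrderedRing R]

/-- **THE UNIVERSAL PURE CHAIN FOR THE FILTER GATE OF AN ENTERED CLUSTER `z`** (the gate
`d·1[z ⊆ W]`): under the head hypotheses of the chain, positive world masses and a positive ideal
mass, the pure chain functional with gate `d' = d·1[z ⊆ ·]` is nonnegative at EVERY `ρ ∈ [0, 1]`
for every pair of nonnegative increasing markers. -/
theorem pureChain_functional_nonneg_of_filterGate (U ent' : Finset V) (ν c d : Finset V → R)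
    (z : Finset V) (hz : ∃ r ∈ ent', r ∈ z)
    (ρ : R) (hρ0 : 0 ≤ ρ) (hρ1 : ρ ≤ 1) (hν0 : ∀ W, 0 ≤ ν W)
    (hν : ∀ s ⊆ U, ∀ t ⊆ U, ν s * ν t ≤ ν (s ∩ t) * ν (s ∪ t))
    (hc0 : ∀ W, 0 ≤ c W) (hd0 : ∀ W, 0 ≤ d W) (hdc : ∀ W, d W ≤ c W)
    (hcc : ∀ s t, c s * c t ≤ c (s ∩ t) * c (s ∪ t))
    (hdd : ∀ s t, d s * d t ≤ d (s ∩ t) * d (s ∪ t))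
    (hcd : ∀ s t, c s * d t ≤ c (s ∩ t) * d (s ∪ t))
    (hratio : ∀ s t, s ⊆ t → d s * c t ≤ c s * d t)
    (x y : Finset V → R) (hx0 : ∀ W, 0 ≤ x W) (hy0 : ∀ W, 0 ≤ y W)
    (hxm : ∀ s t, x s ≤ x (s ∪ t)) (hym : ∀ s t, y s ≤ y (s ∪ t))
    (hpos0 : 0 < ∑ W ∈ U.powerset, ν W * c W)
    (hpos1 : 0 < ∑ W ∈ U.powerset, ν W * chainMix ∅ ent' 1 c d W)
    (hmI : 0 < ∑ W ∈ U.powerset.filter (fun W => ¬ ∃ r ∈ ent', r ∈ W), ν W * c W) :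
    0 ≤ (∑ W ∈ U.powerset, ν W * chainMix ∅ ent' ρ c d W) ^ 2 *
          (∑ W ∈ U.powerset, ν W * chainMix ∅ ent' ρ c (fun W => if z ⊆ W then d W else 0) W * (x W * y W))
        - (∑ W ∈ U.powerset, ν W * chainMix ∅ ent' ρ c d W) *
          (∑ W ∈ U.powerset, ν W * chainMix ∅ ent' ρ c d W * x W) *
          (∑ W ∈ U.powerset, ν W * chainMix ∅ ent' ρ c (fun W => if z ⊆ W then d W else 0) W * y W)
        - (∑ W ∈ U.powerset, ν W * chainMix ∅ ent' ρ c d W) *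
          (∑ W ∈ U.powerset, ν W * chainMix ∅ ent' ρ c d W * y W) *
          (∑ W ∈ U.powerset, ν W * chainMix ∅ ent' ρ c (fun W => if z ⊆ W then d W else 0) W * x W)
        + (∑ W ∈ U.powerset, ν W * chainMix ∅ ent' ρ c d W * x W) *
          (∑ W ∈ U.powerset, ν W * chainMix ∅ ent' ρ c d W * y W) *
          (∑ W ∈ U.powerset, ν W * chainMix ∅ ent' ρ c (fun W => if z ⊆ W then d W else 0) W) := by
  refine pureChain_functional_nonneg_of_enteredPart U ent' ν c d (fun W => if z ⊆ W then d W else 0)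
    ρ hρ0 hρ1 hν0 hν hc0 hd0 (filterGate_nonneg d hd0 z) hdc
    (fun W => le_trans (filterGate_le d hd0 z W) (hdc W)) (filterGate_le d hd0 z) hcc hdd
    (filterGate_lsm d hd0 hdd z) hcd (filterGate_cross_c c d hc0 hd0 hcd z) (filterGate_cross_d d hd0 hdd z)
    hratio (filterGate_ratio c d hc0 hd0 hratio z) x y hx0 hy0 hxm hym hpos0 hpos1 hmI ?_
  exact filterGate_entered_nonneg U ent' ν c d z hz hν0 hν hc0 hd0 hdc hdd hcd x y hx0 hy0 hxm hym

end FilterGateMain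

end Summit.Ventures.PercRepro2.Coin
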